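import Summits.AtomisticToContinuum.Crystallization.Theorems.FrustratedLawDichotomyBumpRadialCertLJ
import Mathlib.Analysis.SpecialFunctions.ImproperIntegrals

/-!
# FrustratedLawDichotomy · an EXPLICIT radial dominator `kappaL` for `SF₄₅`: everything but ONE near-field inequality on `(3, 109/20]` DISCHARGED

`…BumpRadialCertLJ.sf₄₅_of_nearCert` (hand-1 g13) proves `SF₄₅` from any continuous `κ ≥ 0` with the Lennard-Jones tail `s⁻⁶/(6M)` beyond
`R₁ − 8/5`, a near-field domination inequality on `3 < r ≤ R₁`, and the budget `4π(∫ s²κ)·(4/5)³·256π/3465 ≤ 3/400`.  THIS FILE fixes the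
dominator — lens-5 g34's closed form (NODE-g34.md §3bis) with the smoothstep switch replaced by a LINEAR switch on `[67/20, 77/20]` so that the
budget is a RATIONAL number (`π` cancels against `M = (32π(4/5)³/105)²`):

  `kappaL(s) = (max s 1)⁻⁶/(6M) · clamp(2s − 67/10, 0, 1)`  (`= 0` for `s ≤ 67/20`, `= s⁻⁶/(6M)` for `s ≥ 77/20`, continuous, `≥ 0`),

and DISCHARGES: continuity / sign / tail (§1), `∫_{s>0} s²kappaL = (6M)⁻¹·192000/26615281` (interval piece by the antiderivative
`−s⁻² + (67/30)s⁻³`, tail by `integral_Ioi_rpow_of_lt`) and ★ `budget_kappaL : 4π(∫ s²kappaL)·(4/5)³·256π/3465 ≤ 3/400` (value `0.0074718`; §2).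
★★★ `sf₄₅_of_nearIneq`: `SF₄₅` — the Schur floor beneath the residual of record `T′♭₄₅` of column 27623 — follows from the SINGLE inequality

  `∀ r ∈ (3, 109/20]:  −(V·w₄₅)(r) ≤ (4/5)³·(512π/3465)·(2π/r)·∫_{s>0} s·kappaL(s)·(∫_{|r−s|}^{r+s} τ·omega₂(5τ/4) dτ) ds`

between explicit elementary functions of ONE variable (numerically: min ratio RHS/LHS `= 1.0287` at `r ≈ 3.56`, hand-1 g13
`scratch/kappa_variants.py`; lens-5's smoothstep variant has `1.0219` and budget `0.0074620`) — an interval-arithmetic certificate on a compact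
range, i.e. census's TAG 181-S(i) object in final Lean-facing form.  [folklore]; 0 sorry.  Prover hand 1, gen 13 (decomp-a2c),
`--supports stmt-AtomisticToContinuum-27623`.
-/

noncomputable section

namespace Summit.AtomisticToContinuum.Crystallization.Theorems.FrustratedLawDichotomyBumpAutocorrelation

open MeasureTheory Set Real
open scoped BigOperators
open Summit.AtomisticToContinuum.Crystallization.Theorems.FrustratedLawDichotomySchurCut (omega₂ SchurFloor tailPot SF₄₅ w₄₅ ω₄)

/-! ## §1. The explicit dominator `kappaL` (Lennard-Jones tail `s⁻⁶/(6M)` switched on linearly across `[67/20, 77/20]`) -/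

/-- The tail constant `M = (32π(4/5)³/105)² = ∫ β_{4/5} ⋆ β_{4/5}`. -/
def tailConst : ℝ := (32 * π * (4 / 5 : ℝ) ^ 3 / 105) ^ 2

/-- `0 < M`. [folklore] -/
theorem tailConst_pos : 0 < tailConst := by unfold tailConst; positivity

/-- The linear switch `ramp s = clamp(2s − 67/10, 0, 1)` (`0` below `67/20`, `1` above `77/20`). -/
def ramp (s : ℝ) : ℝ := max 0 (min 1 (2 * s - 67 / 10))

/-- **The explicit dominator** `kappaL(s) = (max s 1)⁻⁶/(6M)·ramp(s)` (`= s⁻⁶/(6M)` for `s ≥ 77/20`, `= 0` for `s ≤ 67/20`; lens-5 g34's closed form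
with the smoothstep replaced by a linear switch on `[67/20, 77/20]` — near-field margin `2.9 %`, budget `0.0074718 ≤ 3/400`). -/
def kappaL (s : ℝ) : ℝ := (6 * tailConst)⁻¹ * ((max s 1)⁻¹) ^ 6 * ramp s

/-- `ramp` is continuous. [folklore] -/
theorem continuous_ramp : Continuous ramp := by unfold ramp; fun_prop

/-- `0 ≤ ramp s ≤ 1`. [folklore] -/
theorem ramp_mem_Icc (s : ℝ) : ramp s ∈ Icc (0:ℝ) 1 :=
  ⟨le_max_left _ _, max_le zero_le_one (min_le_left _ _)⟩

/-- `ramp s = 0` for `s ≤ 67/20`. [folklore] -/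
theorem ramp_of_le {s : ℝ} (h : s ≤ 67 / 20) : ramp s = 0 := by
  unfold ramp
  rw [max_eq_left]
  exact min_le_of_right_le (by linarith)

/-- `ramp s = 1` for `77/20 ≤ s`. [folklore] -/
theorem ramp_of_ge {s : ℝ} (h : 77 / 20 ≤ s) : ramp s = 1 := by
  unfold ramp
  rw [min_eq_left (by linarith), max_eq_right zero_le_one]

/-- `ramp s = 2s − 67/10` on `[67/20, 77/20]`. [folklore] -/
theorem ramp_of_mem {s : ℝ} (h1 : 67 / 20 ≤ s) (h2 : s ≤ 77 / 20) : ramp s = 2 * s - 67 / 10 := by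
  unfold ramp
  rw [min_eq_right (by linarith), max_eq_right (by linarith)]

/-- `kappaL` is continuous (the factor `(max s 1)⁻¹` has no singularity). [folklore] -/
theorem continuous_kappaL : Continuous kappaL := by
  unfold kappaL
  refine (continuous_const.mul ((Continuous.inv₀ (by fun_prop) fun s => ?_).pow 6)).mul continuous_ramp
  exact ne_of_gt (lt_of_lt_of_le zero_lt_one (le_max_right s 1))

/-- `0 ≤ kappaL`. [folklore] -/
theorem kappaL_nonneg (s : ℝ) : 0 ≤ kappaL s := by
  unfold kappaL
  refine mul_nonneg (mul_nonneg (inv_nonneg.2 (by linarith [tailConst_pos])) (pow_nonneg (inv_nonneg.2 ?_) 6)) (ramp_mem_Icc s).1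
  exact le_trans zero_le_one (le_max_right s 1)

/-- `kappaL s = 0` for `s ≤ 67/20`. [folklore] -/
theorem kappaL_of_le {s : ℝ} (h : s ≤ 67 / 20) : kappaL s = 0 := by simp [kappaL, ramp_of_le h]

/-- The tail: `kappaL s = (6M)⁻¹·s⁻⁶` for `s ≥ 77/20`. [folklore] -/
theorem kappaL_tail {s : ℝ} (h : 77 / 20 ≤ s) : kappaL s = (6 * (32 * π * (4 / 5 : ℝ) ^ 3 / 105) ^ 2)⁻¹ * (s⁻¹) ^ 6 := by
  rw [kappaL, ramp_of_ge h, max_eq_left (by linarith), mul_one, tailConst]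

/-- On `[67/20, 77/20]`: `s²·kappaL s = (6M)⁻¹·(2s⁻³ − (67/10)s⁻⁴)`. [folklore] -/
theorem sq_mul_kappaL_of_mem {s : ℝ} (h1 : 67 / 20 ≤ s) (h2 : s ≤ 77 / 20) :
    s ^ 2 * kappaL s = (6 * tailConst)⁻¹ * (2 * s ^ (-3 : ℤ) - 67 / 10 * s ^ (-4 : ℤ)) := by
  have hs : 0 < s := by linarith
  rw [kappaL, ramp_of_mem h1 h2, max_eq_left (by linarith), show (-3 : ℤ) = -((3 : ℕ) : ℤ) by norm_num,
    show (-4 : ℤ) = -((4 : ℕ) : ℤ) by norm_num, zpow_neg, zpow_neg, zpow_natCast, zpow_natCast]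
  field_simp

/-- On `[77/20, ∞)`: `s²·kappaL s = (6M)⁻¹·s^(−4)` (real power). [folklore] -/
theorem sq_mul_kappaL_of_ge {s : ℝ} (h : 77 / 20 ≤ s) : s ^ 2 * kappaL s = (6 * tailConst)⁻¹ * s ^ (-4 : ℝ) := by
  have hs : 0 < s := by linarith
  rw [kappaL, ramp_of_ge h, max_eq_left (by linarith), mul_one,
    show (-4 : ℝ) = -((4 : ℕ) : ℝ) by norm_num, Real.rpow_neg hs.le, Real.rpow_natCast]
  field_simp

/-! ## §2. The `L¹` budget of `kappaL`: an exact rational computation (π cancels) -/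

/-- The finite part: `∫_{67/20}^{77/20} s²kappaL = (6M)⁻¹ · 8440000/6148129911`. [folklore] -/
theorem integral_sq_kappaL_mid :
    ∫ s in (67 / 20 : ℝ)..(77 / 20), s ^ 2 * kappaL s = (6 * tailConst)⁻¹ * (8440000 / 6148129911) := by
  have hle : (67 / 20 : ℝ) ≤ 77 / 20 := by norm_num
  rw [intervalIntegral.integral_congr (g := fun s => (6 * tailConst)⁻¹ * (2 * s ^ (-3 : ℤ) - 67 / 10 * s ^ (-4 : ℤ))) (fun s hs => by
    rw [uIcc_of_le hle] at hs; exact sq_mul_kappaL_of_mem hs.1 hs.2)]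
  rw [intervalIntegral.integral_const_mul]
  congr 1
  -- antiderivative F(s) = -s⁻² + (67/30) s⁻³
  have hderiv : ∀ s ∈ uIcc (67 / 20 : ℝ) (77 / 20),
      HasDerivAt (fun s : ℝ => -s ^ (-2 : ℤ) + 67 / 30 * s ^ (-3 : ℤ)) (2 * s ^ (-3 : ℤ) - 67 / 10 * s ^ (-4 : ℤ)) s := by
    intro s hs
    rw [uIcc_of_le hle] at hs
    have hs0 : s ≠ 0 := by intro h; rw [h] at hs; norm_num at hs
    have h := ((hasDerivAt_zpow (-2) s (Or.inl hs0)).neg).add ((hasDerivAt_zpow (-3) s (Or.inl hs0)).const_mul (67 / 30))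
    refine h.congr_deriv ?_
    push_cast
    norm_num
    ring
  have hcont : ContinuousOn (fun s : ℝ => 2 * s ^ (-3 : ℤ) - 67 / 10 * s ^ (-4 : ℤ)) (uIcc (67 / 20 : ℝ) (77 / 20)) := by
    rw [uIcc_of_le hle]
    have hne : ∀ x ∈ Icc (67 / 20 : ℝ) (77 / 20), x ≠ 0 := fun x hx h0 => by rw [h0] at hx; norm_num at hx
    exact (continuousOn_const.mul (continuousOn_id.zpow₀ (-3) fun x hx => Or.inl (hne x hx))).sub
      (continuousOn_const.mul (continuousOn_id.zpow₀ (-4) fun x hx => Or.inl (hne x hx)))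
  rw [intervalIntegral.integral_eq_sub_of_hasDerivAt hderiv (hcont.intervalIntegrable)]
  simp only [zpow_neg, zpow_ofNat]
  norm_num

/-- The tail part: `∫_{77/20}^∞ s²kappaL = (6M)⁻¹ · 8000/1369599`. [folklore] -/
theorem integral_sq_kappaL_tail : ∫ s in Ioi (77 / 20 : ℝ), s ^ 2 * kappaL s = (6 * tailConst)⁻¹ * (8000 / 1369599) := by
  rw [setIntegral_congr_fun measurableSet_Ioi (fun s (hs : (77/20:ℝ) < s) => sq_mul_kappaL_of_ge hs.le), integral_const_mul,
    integral_Ioi_rpow_of_lt (by norm_num) (by norm_num)]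
  congr 1
  rw [show (-4 : ℝ) + 1 = -((3 : ℕ) : ℝ) by norm_num, Real.rpow_neg (by norm_num), Real.rpow_natCast]
  norm_num

/-- `s²kappaL` is integrable on `(0, ∞)`. [folklore] -/
theorem integrableOn_sq_kappaL : IntegrableOn (fun s => s ^ 2 * kappaL s) (Ioi 0) := by
  have h1 : IntegrableOn (fun s => s ^ 2 * kappaL s) (Icc 0 (77 / 20)) :=
    ((continuous_pow 2).mul continuous_kappaL).continuousOn.integrableOn_Icc
  have h2 : IntegrableOn (fun s => s ^ 2 * kappaL s) (Ioi (77 / 20)) := by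
    have h2' : IntegrableOn (fun s : ℝ => (6 * tailConst)⁻¹ * s ^ (-4 : ℝ)) (Ioi (77 / 20)) :=
      (integrableOn_Ioi_rpow_of_lt (by norm_num : (-4:ℝ) < -1) (by norm_num : (0:ℝ) < 77 / 20)).const_mul (6 * tailConst)⁻¹
    exact IntegrableOn.congr_fun h2' (fun s (hs : (77/20:ℝ) < s) => (sq_mul_kappaL_of_ge hs.le).symm) measurableSet_Ioi
  exact (h1.union h2).mono_set fun s (hs : 0 < s) => by
    rcases le_or_gt s (77 / 20) with h | h
    · exact Or.inl ⟨hs.le, h⟩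
    · exact Or.inr h

/-- `∫_{s>0} s²kappaL = (6M)⁻¹ · 192000/26615281`. [folklore] -/
theorem integral_sq_kappaL : ∫ s in Ioi (0:ℝ), s ^ 2 * kappaL s = (6 * tailConst)⁻¹ * (192000 / 26615281) := by
  -- drop (0, 67/20], where the integrand vanishes
  rw [setIntegral_eq_of_subset_of_forall_sdiff_eq_zero measurableSet_Ioi (Ioi_subset_Ioi (by norm_num) : Ioi (67/20:ℝ) ⊆ Ioi 0)]
  swap
  · rintro s ⟨-, h2⟩
    have : s ≤ 67 / 20 := not_lt.mp h2
    simp [kappaL_of_le this]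
  rw [← Ioc_union_Ioi_eq_Ioi (by norm_num : (67/20:ℝ) ≤ 77/20),
    setIntegral_union Ioc_disjoint_Ioi_same measurableSet_Ioi
      (integrableOn_sq_kappaL.mono_set fun s hs => lt_trans (by norm_num) hs.1)
      (integrableOn_sq_kappaL.mono_set fun s (hs : (77/20:ℝ) < s) => lt_trans (by norm_num) hs),
    ← intervalIntegral.integral_of_le (by norm_num : (67/20:ℝ) ≤ 77/20), integral_sq_kappaL_mid, integral_sq_kappaL_tail, ← mul_add]
  norm_num

/-- ★ **THE BUDGET OF `kappaL`**: `4π·(∫_{s>0} s²kappaL)·(4/5)³·256π/3465 ≤ 3/400` (`π` cancels; the value is `0.0074718`). [folklore] -/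
theorem budget_kappaL : 4 * π * (∫ s in Ioi (0:ℝ), s ^ 2 * kappaL s) * ((4 / 5 : ℝ) ^ 3 * (256 * π / 3465)) ≤ 3 / 400 := by
  rw [integral_sq_kappaL, tailConst]
  have hπ : π ≠ 0 := Real.pi_ne_zero
  rw [show 4 * π * ((6 * (32 * π * (4 / 5 : ℝ) ^ 3 / 105) ^ 2)⁻¹ * (192000 / 26615281)) * ((4 / 5 : ℝ) ^ 3 * (256 * π / 3465)) =
      4 * ((6 * (32 * (4 / 5 : ℝ) ^ 3 / 105) ^ 2)⁻¹ * (192000 / 26615281)) * ((4 / 5 : ℝ) ^ 3 * (256 / 3465)) by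
    field_simp]
  norm_num

/-! ## §3. `SF₄₅` from ONE near-field inequality -/

/-- ★★★ **`SF₄₅` ⟸ ONE ONE-VARIABLE INEQUALITY ON `[3, 109/20]`.**  With the explicit dominator `kappaL`, every hypothesis of
`sf₄₅_of_nearCert` is discharged except the near-field domination on `3 < r ≤ 109/20`:
`−(V·w₄₅)(r) ≤ (4/5)³·(512π/3465)·(2π/r)·∫_{s>0} s·kappaL(s)·∫_{|r−s|}^{r+s} τ·omega₂(5τ/4) dτ ds`
(numerically: min ratio RHS/LHS = 1.0287 at r ≈ 3.56; hand-1 g13 scratch/kappa_variants.py).  An interval-arithmetic certificate of this single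
inequality between explicit elementary functions on a compact range makes `SF₄₅` — the floor of record of column 27623 — a theorem. [folklore chaining] -/
theorem sf₄₅_of_nearIneq
    (hnear : ∀ r, 3 < r → r ≤ 109 / 20 → -(tailPot w₄₅ r) ≤
      (4 / 5 : ℝ) ^ 3 * (512 * π / 3465) * (2 * π / r * ∫ s in Ioi 0, s * kappaL s * ∫ τ in |r - s|..(r + s), τ * omega₂ (τ / (4 / 5)))) :
    SF₄₅ :=
  sf₄₅_of_nearCert kappaL continuous_kappaL kappaL_nonneg integrableOn_sq_kappaL (109 / 20) (by norm_num)
    (fun s hs => kappaL_tail (by linarith)) hnear budget_kappaL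

end Summit.AtomisticToContinuum.Crystallization.Theorems.FrustratedLawDichotomyBumpAutocorrelation

end
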